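import Mathlib.Analysis.Calculus.FDeriv.Symmetric
import Mathlib.Analysis.Calculus.IteratedDeriv.Lemmas
import Mathlib.Analysis.Calculus.ContDiff.Basic
import Mathlib.Analysis.Calculus.Deriv.Prod
import HarnessLib

/-!
# Adapted words are nested partials: the jets of `z = (q, t) ↦ Φ (g q) t` on words of NORMAL (`(0,1)`) and TRANSVERSAL (`(v,0)`) letters,
# for a functional `Φ` differentiating its parameter family under itself (Hörmander, ALPDO I §1.1; Bouaziz 1994 §3.2 (I₃); Shelstad 1979 Lemma 4.3)

Topic `Analysis/Calculus`; namespace `Literature.Analysis.Calculus`.  THEOREMS ONLY (no `def`, no instance, no notation, no axiom, no named fact, no `sorry`),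
Mathlib-only.  Cell `pub/hodgecm-mathlib`, crux H413 (`stmt-HodgeConjecture-24833`), F0∕P3c line LH3 (closer stub `stub_N9`, letter L1 clause (I₃) `ArchHcJump`), SPEC-I3
(F0P3a-p08 (g23)) brick **(W)+(B-par, calculus half)** — the GROUP-FREE word calculus under (B-trans) «adapted words».

THE SETTING.  A real normed «parameter» space `P`, an arbitrary argument type `Y`, test-function families `g : P → Y → ℂ`, a class `Adm` of admissible families closed
under the transversal derivative `∂ᵥ g := fun q y => fderiv ℝ (fun q' => g q' y) q v`, and a READER `Φ : (Y → ℂ) → ℝ → F` (an orbital-integral functional in the line's use) with an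
open set `T ⊆ ℝ` (the punctured normal interval, or all of `ℝ` on the split side) such that for every admissible `g`: (H1) `z ↦ Φ (g z.1) z.2` is `C^∞` on `univ ×ˢ T`, and (H2) its
derivative in a parameter direction `(v, 0)` is the reader of the differentiated family: `fderiv ℝ (fun z => Φ (g z.1) z.2) z (v, 0) = Φ (∂ᵥ g z.1) z.2` (differentiation under
the functional — the ANALYTIC input, supplied per reader by its owner).  Then:
* §1 directional derivatives on an open set: `EqOn`-stability, smoothness, SCHWARZ `∂_u ∂_{u′} ψ = ∂_{u′} ∂_u ψ` (Mathlib `ContDiffAt.isSymmSndFDerivAt`, `C²` over `ℝ`), commuting one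
  direction past an iterate of another, and the slice formula `iteratedDeriv a (fun t => ψ (q,t)) t = (∂_{(0,1)})^[a] ψ (q,t)`.
* §2 **`fderiv_iteratedDeriv_reader_transversal`** — `∂_{(v,0)} (z ↦ (Φ (g z.1))⁽ᵃ⁾(z.2)) = (Φ (∂ᵥ g z.1))⁽ᵃ⁾(z.2)` on `univ ×ˢ T` (the order-`a` form of (H2): the transversal
  derivative passes EVERY normal jet), **`fderiv_iteratedDeriv_reader_normal`** (`∂_{(0,1)}` raises the jet order), `contDiffOn_iteratedDeriv_reader`.
* §3 **`exists_family_iteratedFDeriv_readers_eq_iteratedDeriv`** — THE NORMAL FORM, simultaneously for a FAMILY of readers `Φ i`, `T i` (`i : ι`) sharing `P, Y, Adm`: for every word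
  `w : Fin k → P × ℝ` whose letters are NORMAL (`w r = (0,1)`) or TRANSVERSAL (`(w r).2 = 0`) as recorded by `σ : Fin k → Bool`, and every admissible `g`, there is ONE admissible
  `g′` (the nested transversal derivative of `g` along the transversal letters, outermost letter last) with
  `iteratedFDeriv ℝ k (fun z => Φ i (g z.1) z.2) z w = iteratedDeriv #{r | σ r} (Φ i (g′ z.1)) z.2` for every `i` and every `z ∈ univ ×ˢ T i` — words are read IN ORDER as nested
  directional derivatives (Mathlib `DifferentiableAt.iteratedFDeriv_succ_apply_left'`), so NO permutation symmetry of `iteratedFDeriv` is used (Mathlib has it only for analytic maps).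
USE (SPEC-I3 (B-trans)): `ι = {compact chart, split chart}`, `Φ₁ = ` the (ELL-∞) functional `F` on `T₁ = {0 < |ν| < δ}`, `Φ₂ =` the split functional `Λ` on `T₂ = univ`, ONE block
family `g`; the adapted letters of ★ `hcAdaptedVec`∕`hcCayVec` become `(0,1)`∕`(v,0)` after the affine chart `c ↦ (π c, ν c)` resp. `c″ ↦ (B c″, x c″)`; the one-sided jumps of the
normal jets of `Φ₁ (g′ q₀)` ((ELL-∞) ★ + (A0-CASIMIR-∞)) then read on BOTH sides with the SAME `g′`.
HONEST LABEL: pure calculus, count-neutral; HC_CM is proved only modulo the 7 printed citations (2 remaining: hLiu418 = stmt-HodgeConjecture-24832, h413 = stmt-HodgeConjecture-24833)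
until rung 0 closes.

## References
* [HormanderALPDO1] L. Hörmander, *The Analysis of Linear Partial Differential Operators I* (1983∕2003), §1.1 Thm. 1.1.8 (symmetry of higher differentials), (1.1.9) p. 12.
* [Bouaziz1994IntegralesOrbitales] A. Bouaziz, *Intégrales orbitales sur les groupes de Lie réductifs*, Ann. Sci. ÉNS 27 (1994), §3.2 (I₃) p. 580 (adapted derivatives `∂(u)`).
* [Shelstad1979] D. Shelstad, *Characters and inner forms of a quasi-split group over ℝ*, Compositio Math. 39 (1979), Lemma 4.3 p. 25 (the word algebra `I⁺`, Cayley images).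
-/

set_option autoImplicit false

open Set Filter Function
open scoped Topology ContDiff

namespace Literature.Analysis.Calculus

/-! ## §1 Directional derivatives of functions smooth on an open set -/

section Directional

variable {E : Type*} [NormedAddCommGroup E] [NormedSpace ℝ E] {F : Type*} [NormedAddCommGroup F] [NormedSpace ℝ F]

/-- Functions agreeing on an open set have the same directional derivatives there. [cite: HormanderALPDO1, §1.1 (1.1.9)] -/
theorem eqOn_fderiv_apply_of_eqOn {O : Set E} (hO : IsOpen O) {ψ₁ ψ₂ : E → F} (h : EqOn ψ₁ ψ₂ O) (u : E) :
    EqOn (fun z => fderiv ℝ ψ₁ z u) (fun z => fderiv ℝ ψ₂ z u) O := fun z hz => by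
  have he : ψ₁ =ᶠ[𝓝 z] ψ₂ := Filter.eventuallyEq_of_mem (hO.mem_nhds hz) h
  simp only [he.fderiv_eq]

/-- Iterating a directional derivative preserves agreement on an open set. [cite: HormanderALPDO1, §1.1 (1.1.9)] -/
theorem eqOn_iterate_fderiv_apply_of_eqOn {O : Set E} (hO : IsOpen O) {ψ₁ ψ₂ : E → F} (h : EqOn ψ₁ ψ₂ O) (u : E) (a : ℕ) :
    EqOn ((fun ψ : E → F => fun z => fderiv ℝ ψ z u)^[a] ψ₁) ((fun ψ : E → F => fun z => fderiv ℝ ψ z u)^[a] ψ₂) O := by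
  induction a with
  | zero => simpa using h
  | succ a ih =>
    simp only [Function.iterate_succ', Function.comp_apply]
    exact eqOn_fderiv_apply_of_eqOn hO ih u

/-- A directional derivative of a function `C^∞` on an open set is `C^∞` there. [cite: HormanderALPDO1, §1.1 Thm. 1.1.8] -/
theorem contDiffOn_fderiv_apply_of_isOpen {O : Set E} (hO : IsOpen O) {ψ : E → F} (hψ : ContDiffOn ℝ ∞ ψ O) (u : E) :
    ContDiffOn ℝ ∞ (fun z => fderiv ℝ ψ z u) O := by
  have h1 : ContDiffOn ℝ ∞ (fderiv ℝ ψ) O := hψ.fderiv_of_isOpen hO (by exact_mod_cast le_top)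
  exact h1.clm_apply contDiffOn_const

/-- Iterated directional derivatives of a function `C^∞` on an open set are `C^∞` there. [cite: HormanderALPDO1, §1.1 Thm. 1.1.8] -/
theorem contDiffOn_iterate_fderiv_apply_of_isOpen {O : Set E} (hO : IsOpen O) {ψ : E → F} (hψ : ContDiffOn ℝ ∞ ψ O) (u : E) (a : ℕ) :
    ContDiffOn ℝ ∞ ((fun ψ : E → F => fun z => fderiv ℝ ψ z u)^[a] ψ) O := by
  induction a with
  | zero => simpa using hψ
  | succ a ih =>
    rw [Function.iterate_succ', Function.comp_apply]
    exact contDiffOn_fderiv_apply_of_isOpen hO ih u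

/-- **SCHWARZ for directional derivatives** of a function `C^∞` on an open set: `∂_u ∂_{u′} ψ = ∂_{u′} ∂_u ψ` on `O` (Mathlib's `ContDiffAt.isSymmSndFDerivAt`, `C²` over `ℝ`).
[cite: HormanderALPDO1, §1.1 Thm. 1.1.8] -/
theorem fderiv_fderiv_apply_comm_of_isOpen {O : Set E} (hO : IsOpen O) {ψ : E → F} (hψ : ContDiffOn ℝ ∞ ψ O) (u u' : E) {z : E} (hz : z ∈ O) :
    fderiv ℝ (fun y => fderiv ℝ ψ y u') z u = fderiv ℝ (fun y => fderiv ℝ ψ y u) z u' := by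
  have hat : ContDiffAt ℝ ∞ ψ z := hψ.contDiffAt (hO.mem_nhds hz)
  have hd : DifferentiableAt ℝ (fderiv ℝ ψ) z :=
    ((hat.fderiv_right (m := ∞) (by exact_mod_cast le_top)).differentiableAt (by simp))
  have h1 : fderiv ℝ (fun y => fderiv ℝ ψ y u') z u = fderiv ℝ (fderiv ℝ ψ) z u u' := by
    rw [fderiv_clm_apply hd (differentiableAt_const u')]
    simp
  have h2 : fderiv ℝ (fun y => fderiv ℝ ψ y u) z u' = fderiv ℝ (fderiv ℝ ψ) z u' u := by
    rw [fderiv_clm_apply hd (differentiableAt_const u)]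
    simp
  rw [h1, h2]
  have h2le : minSmoothness ℝ 2 ≤ ∞ := by
    simp only [minSmoothness_of_isRCLikeNormedField]
    exact WithTop.coe_le_coe.2 le_top
  exact (hat.isSymmSndFDerivAt h2le).eq u u'

/-- **A directional derivative commutes past an ITERATE of another one** (induction on Schwarz). [cite: HormanderALPDO1, §1.1 Thm. 1.1.8] -/
theorem fderiv_iterate_fderiv_apply_comm_of_isOpen {O : Set E} (hO : IsOpen O) {ψ : E → F} (hψ : ContDiffOn ℝ ∞ ψ O) (u u' : E) (a : ℕ) :
    EqOn (fun z => fderiv ℝ ((fun φ : E → F => fun y => fderiv ℝ φ y u')^[a] ψ) z u)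
      ((fun φ : E → F => fun y => fderiv ℝ φ y u')^[a] (fun y => fderiv ℝ ψ y u)) O := by
  induction a with
  | zero => intro z _; simp
  | succ a ih =>
    intro z hz
    have hsm := contDiffOn_iterate_fderiv_apply_of_isOpen hO hψ u' a
    -- `∂_u ∂_{u′} (∂_{u′}^a ψ) = ∂_{u′} ∂_u (∂_{u′}^a ψ) = ∂_{u′} (∂_{u′}^a ∂_u ψ)`
    simp only [Function.iterate_succ', Function.comp_apply]
    rw [fderiv_fderiv_apply_comm_of_isOpen hO hsm u u' hz]
    exact eqOn_fderiv_apply_of_eqOn hO ih u' hz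

end Directional

/-! ### The slice formula on a product `P × ℝ` -/

section Slice

variable {P : Type*} [NormedAddCommGroup P] [NormedSpace ℝ P] {F : Type*} [NormedAddCommGroup F] [NormedSpace ℝ F]

/-- The `t`-derivative of a slice `t ↦ ψ (q, t)` is the directional derivative of `ψ` along `(0, 1)`. [cite: HormanderALPDO1, §1.1 (1.1.9)] -/
theorem deriv_slice_eq_fderiv_apply {ψ : P × ℝ → F} {q : P} {t : ℝ} (hψ : DifferentiableAt ℝ ψ (q, t)) :
    deriv (fun s : ℝ => ψ (q, s)) t = fderiv ℝ ψ (q, t) ((0 : P), (1 : ℝ)) := by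
  have hi : HasDerivAt (fun s : ℝ => ((q, s) : P × ℝ)) ((0 : P), (1 : ℝ)) t := by
    refine HasDerivAt.prodMk ?_ (hasDerivAt_id t)
    simpa using hasDerivAt_const t q
  have := (hψ.hasFDerivAt.comp_hasDerivAt t hi)
  exact this.deriv

/-- **THE SLICE FORMULA**: on the open set `univ ×ˢ T`, `iteratedDeriv a (fun t => ψ (q, t)) t = (∂_{(0,1)})^[a] ψ (q, t)`. [cite: HormanderALPDO1, §1.1 (1.1.9)] -/
theorem iteratedDeriv_slice_eq_iterate_fderiv_apply {T : Set ℝ} (hT : IsOpen T) {ψ : P × ℝ → F} (hψ : ContDiffOn ℝ ∞ ψ (univ ×ˢ T)) (a : ℕ)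
    {q : P} {t : ℝ} (ht : t ∈ T) :
    iteratedDeriv a (fun s : ℝ => ψ (q, s)) t = ((fun φ : P × ℝ → F => fun y => fderiv ℝ φ y ((0 : P), (1 : ℝ)))^[a] ψ) (q, t) := by
  have hO : IsOpen (univ ×ˢ T : Set (P × ℝ)) := isOpen_univ.prod hT
  induction a generalizing t with
  | zero => simp
  | succ a ih =>
    rw [iteratedDeriv_succ, Function.iterate_succ', Function.comp_apply]
    -- the `a`-th slice derivative agrees near `t` with the slice of `∂_{(0,1)}^a ψ`
    have hev : (iteratedDeriv a fun s : ℝ => ψ (q, s)) =ᶠ[𝓝 t]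
        fun s => ((fun φ : P × ℝ → F => fun y => fderiv ℝ φ y ((0 : P), (1 : ℝ)))^[a] ψ) (q, s) :=
      Filter.eventuallyEq_of_mem (hT.mem_nhds ht) fun s hs => ih hs
    rw [hev.deriv_eq]
    have hsm := contDiffOn_iterate_fderiv_apply_of_isOpen hO hψ ((0 : P), (1 : ℝ)) a
    have hd : DifferentiableAt ℝ ((fun φ : P × ℝ → F => fun y => fderiv ℝ φ y ((0 : P), (1 : ℝ)))^[a] ψ) (q, t) :=
      (hsm.contDiffAt (hO.mem_nhds ⟨mem_univ _, ht⟩)).differentiableAt (by simp)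
    exact deriv_slice_eq_fderiv_apply hd

end Slice

/-! ## §2 Readers: the transversal derivative passes every normal jet; the normal derivative raises the jet order -/

section Reader

variable {P : Type*} [NormedAddCommGroup P] [NormedSpace ℝ P] {Y : Type*} {V : Type*} {F : Type*} [NormedAddCommGroup F] [NormedSpace ℝ F]

/-- **THE TRANSVERSAL DERIVATIVE PASSES EVERY NORMAL JET.**  If `z ↦ Φ (g z.1) z.2` is `C^∞` on `univ ×ˢ T` (H1) and its `(v,0)`-derivative there is `Φ (∂ᵥ g z.1) z.2` (H2), then for
every `a`: `∂_{(v,0)} (z ↦ iteratedDeriv a (Φ (g z.1)) z.2) = iteratedDeriv a (Φ (∂ᵥ g z.1)) z.2` on `univ ×ˢ T`. [cite: HormanderALPDO1, §1.1 Thm. 1.1.8, (1.1.9)]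
[cite: Bouaziz1994IntegralesOrbitales, §3.2 (I₃) p. 580] -/
theorem fderiv_iteratedDeriv_reader_transversal {T : Set ℝ} (hT : IsOpen T) (Φ : (Y → V) → ℝ → F) (g g' : P → Y → V)
    (h1 : ContDiffOn ℝ ∞ (fun z : P × ℝ => Φ (g z.1) z.2) (univ ×ˢ T)) (h1' : ContDiffOn ℝ ∞ (fun z : P × ℝ => Φ (g' z.1) z.2) (univ ×ˢ T)) (v : P)
    (h2 : ∀ z : P × ℝ, z.2 ∈ T → fderiv ℝ (fun z : P × ℝ => Φ (g z.1) z.2) z (v, 0) = Φ (g' z.1) z.2) (a : ℕ)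
    {z : P × ℝ} (hz : z.2 ∈ T) :
    fderiv ℝ (fun y : P × ℝ => iteratedDeriv a (Φ (g y.1)) y.2) z (v, 0) = iteratedDeriv a (Φ (g' z.1)) z.2 := by
  have hO : IsOpen (univ ×ˢ T : Set (P × ℝ)) := isOpen_univ.prod hT
  have hzO : z ∈ (univ ×ˢ T : Set (P × ℝ)) := ⟨mem_univ _, hz⟩
  set D : (P × ℝ → F) → (P × ℝ → F) := fun φ y => fderiv ℝ φ y ((0 : P), (1 : ℝ)) with hD
  -- both sides are slices of iterated `(0,1)`-derivatives
  have hL : EqOn (fun y : P × ℝ => iteratedDeriv a (Φ (g y.1)) y.2) (D^[a] fun y : P × ℝ => Φ (g y.1) y.2) (univ ×ˢ T) := by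
    rintro ⟨q, t⟩ ⟨-, ht⟩
    exact iteratedDeriv_slice_eq_iterate_fderiv_apply hT h1 a ht
  have e1 := eqOn_fderiv_apply_of_eqOn hO hL (v, 0) hzO
  simp only [] at e1
  rw [e1]
  -- commute `∂_{(v,0)}` past `D^[a]`, then use (H2) inside, then slice back
  have e2 := fderiv_iterate_fderiv_apply_comm_of_isOpen hO h1 (v, 0) ((0 : P), (1 : ℝ)) a hzO
  simp only [] at e2
  rw [hD, e2]
  have hin : EqOn (fun y : P × ℝ => fderiv ℝ (fun z : P × ℝ => Φ (g z.1) z.2) y (v, 0)) (fun y : P × ℝ => Φ (g' y.1) y.2) (univ ×ˢ T) :=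
    fun y hy => h2 y hy.2
  rw [eqOn_iterate_fderiv_apply_of_eqOn hO hin ((0 : P), (1 : ℝ)) a hzO]
  obtain ⟨q, t⟩ := z
  exact (iteratedDeriv_slice_eq_iterate_fderiv_apply hT h1' a hz).symm

/-- **THE NORMAL DERIVATIVE RAISES THE JET ORDER**: `∂_{(0,1)} (z ↦ iteratedDeriv a (Φ (g z.1)) z.2) = iteratedDeriv (a+1) (Φ (g z.1)) z.2` on `univ ×ˢ T`.
[cite: HormanderALPDO1, §1.1 (1.1.9)] -/
theorem fderiv_iteratedDeriv_reader_normal {T : Set ℝ} (hT : IsOpen T) (Φ : (Y → V) → ℝ → F) (g : P → Y → V)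
    (h1 : ContDiffOn ℝ ∞ (fun z : P × ℝ => Φ (g z.1) z.2) (univ ×ˢ T)) (a : ℕ) {z : P × ℝ} (hz : z.2 ∈ T) :
    fderiv ℝ (fun y : P × ℝ => iteratedDeriv a (Φ (g y.1)) y.2) z ((0 : P), (1 : ℝ)) = iteratedDeriv (a + 1) (Φ (g z.1)) z.2 := by
  have hO : IsOpen (univ ×ˢ T : Set (P × ℝ)) := isOpen_univ.prod hT
  have hzO : z ∈ (univ ×ˢ T : Set (P × ℝ)) := ⟨mem_univ _, hz⟩
  have hL : EqOn (fun y : P × ℝ => iteratedDeriv a (Φ (g y.1)) y.2)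
      ((fun φ : P × ℝ → F => fun y => fderiv ℝ φ y ((0 : P), (1 : ℝ)))^[a] fun y : P × ℝ => Φ (g y.1) y.2) (univ ×ˢ T) := by
    rintro ⟨q, t⟩ ⟨-, ht⟩
    exact iteratedDeriv_slice_eq_iterate_fderiv_apply hT h1 a ht
  have e1 := eqOn_fderiv_apply_of_eqOn hO hL ((0 : P), (1 : ℝ)) hzO
  simp only [] at e1
  rw [e1]
  obtain ⟨q, t⟩ := z
  rw [iteratedDeriv_slice_eq_iterate_fderiv_apply hT h1 (a + 1) hz, Function.iterate_succ', Function.comp_apply]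

/-- The normal jets `z ↦ iteratedDeriv a (Φ (g z.1)) z.2` are `C^∞` on `univ ×ˢ T`. [cite: HormanderALPDO1, §1.1 Thm. 1.1.8] -/
theorem contDiffOn_iteratedDeriv_reader {T : Set ℝ} (hT : IsOpen T) (Φ : (Y → V) → ℝ → F) (g : P → Y → V)
    (h1 : ContDiffOn ℝ ∞ (fun z : P × ℝ => Φ (g z.1) z.2) (univ ×ˢ T)) (a : ℕ) :
    ContDiffOn ℝ ∞ (fun y : P × ℝ => iteratedDeriv a (Φ (g y.1)) y.2) (univ ×ˢ T) := by
  have hO : IsOpen (univ ×ˢ T : Set (P × ℝ)) := isOpen_univ.prod hT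
  have hL : EqOn (fun y : P × ℝ => iteratedDeriv a (Φ (g y.1)) y.2)
      ((fun φ : P × ℝ → F => fun y => fderiv ℝ φ y ((0 : P), (1 : ℝ)))^[a] fun y : P × ℝ => Φ (g y.1) y.2) (univ ×ˢ T) := by
    rintro ⟨q, t⟩ ⟨-, ht⟩
    exact iteratedDeriv_slice_eq_iterate_fderiv_apply hT h1 a ht
  exact (contDiffOn_iterate_fderiv_apply_of_isOpen hO h1 _ a).congr hL

end Reader

/-! ## §3 The normal form: adapted words are nested partials, simultaneously for a family of readers -/

section NormalForm

variable {P : Type*} [NormedAddCommGroup P] [NormedSpace ℝ P] {Y : Type*} {V : Type*} {F : Type*} [NormedAddCommGroup F] [NormedSpace ℝ F]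
  {ι : Type*}

/-- **ADAPTED WORDS ARE NESTED PARTIALS — THE NORMAL FORM, for a FAMILY of readers at once.**  Readers `Φ i` (`i : ι`) on open sets `univ ×ˢ T i`, ONE class `Adm` of
admissible families closed under the transversal derivatives `D v` (H-cl), each reader `C^∞` on admissible families (H1) and differentiating the family under itself in the
parameter directions (H2: `∂_{(v,0)} (z ↦ Φ i (g z.1) z.2) = Φ i (D v g z.1) z.2`).  Then for every word `w : Fin k → P × ℝ` of NORMAL letters `(0,1)` (`σ r = true`) and
TRANSVERSAL letters `(v,0)` (`σ r = false`) and every admissible `g`, with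
`g′ := (List.ofFn fun r => (σ r, (w r).1)).foldr (fun l g => if l.1 then g else D l.2 g) g` (the nested transversal derivative of `g` along the transversal letters, the
outermost letter applied LAST — admissible by (H-cl)):  for every reader `i` and every `z` with `z.2 ∈ T i`,
`iteratedFDeriv ℝ k (fun z => Φ i (g z.1) z.2) z w = iteratedDeriv ((List.ofFn σ).count true) (Φ i (g′ z.1)) z.2` — the SAME `g′` for all readers.  Words are read in their
given order (`DifferentiableAt.iteratedFDeriv_succ_apply_left'`); no permutation symmetry of `iteratedFDeriv` is used. [cite: HormanderALPDO1, §1.1 Thm. 1.1.8, (1.1.9)]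
[cite: Bouaziz1994IntegralesOrbitales, §3.2 (I₃) p. 580] [cite: Shelstad1979, Lemma 4.3 (p. 25)] -/
theorem iteratedFDeriv_readers_eq_iteratedDeriv_foldr (T : ι → Set ℝ) (hT : ∀ i, IsOpen (T i)) (Φ : ι → (Y → V) → ℝ → F)
    (Adm : (P → Y → V) → Prop) (D : P → (P → Y → V) → (P → Y → V))
    (hcl : ∀ g, Adm g → ∀ v, Adm (D v g))
    (h1 : ∀ i g, Adm g → ContDiffOn ℝ ∞ (fun z : P × ℝ => Φ i (g z.1) z.2) (univ ×ˢ T i))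
    (h2 : ∀ i g, Adm g → ∀ (v : P) (z : P × ℝ), z.2 ∈ T i → fderiv ℝ (fun z : P × ℝ => Φ i (g z.1) z.2) z (v, 0) = Φ i (D v g z.1) z.2)
    {k : ℕ} (w : Fin k → P × ℝ) (σ : Fin k → Bool) (hwn : ∀ r, σ r = true → w r = ((0 : P), (1 : ℝ))) (hwt : ∀ r, σ r = false → (w r).2 = 0)
    (g : P → Y → V) (hg : Adm g) :
    Adm ((List.ofFn fun r => (σ r, (w r).1)).foldr (fun l g => if l.1 then g else D l.2 g) g) ∧
    ∀ (i : ι) (z : P × ℝ), z.2 ∈ T i →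
      iteratedFDeriv ℝ k (fun z : P × ℝ => Φ i (g z.1) z.2) z w =
        iteratedDeriv ((List.ofFn σ).count true) (Φ i (((List.ofFn fun r => (σ r, (w r).1)).foldr (fun l g => if l.1 then g else D l.2 g) g) z.1)) z.2 := by
  induction k with
  | zero =>
    refine ⟨by simpa using hg, fun i z _ => ?_⟩
    simp
  | succ k ih =>
    -- the tail word and its normal form
    have htn : ∀ r : Fin k, (σ ∘ Fin.succ) r = true → Fin.tail w r = ((0 : P), (1 : ℝ)) := fun r hr => hwn r.succ hr
    have htt : ∀ r : Fin k, (σ ∘ Fin.succ) r = false → (Fin.tail w r).2 = 0 := fun r hr => hwt r.succ hr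
    obtain ⟨hAdmt, hIH⟩ := ih (Fin.tail w) (σ ∘ Fin.succ) htn htt
    set gt : P → Y → V := (List.ofFn fun r : Fin k => ((σ ∘ Fin.succ) r, (Fin.tail w r).1)).foldr (fun l g => if l.1 then g else D l.2 g) g with hgt
    have hfold : (List.ofFn fun r : Fin (k + 1) => (σ r, (w r).1)).foldr (fun l g => if l.1 then g else D l.2 g) g =
        (if σ 0 then gt else D (w 0).1 gt) := by
      rw [List.ofFn_succ, List.foldr_cons]
      rfl
    have hcount : (List.ofFn σ).count true = (if σ 0 then 1 else 0) + (List.ofFn (σ ∘ Fin.succ)).count true := by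
      rw [List.ofFn_succ, List.count_cons]
      cases h0 : σ 0 <;> simp [Nat.add_comm, Function.comp_def]
    rw [hfold, hcount]
    refine ⟨by cases h0 : σ 0 <;> simp [hAdmt, hcl _ hAdmt], fun i z hz => ?_⟩
    have hO : IsOpen (univ ×ˢ T i : Set (P × ℝ)) := isOpen_univ.prod (hT i)
    have hzO : z ∈ (univ ×ˢ T i : Set (P × ℝ)) := ⟨mem_univ _, hz⟩
    -- peel the outermost letter
    have hdiff : DifferentiableAt ℝ (iteratedFDeriv ℝ k (fun z : P × ℝ => Φ i (g z.1) z.2)) z :=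
      ((h1 i g hg).contDiffAt (hO.mem_nhds hzO)).differentiableAt_iteratedFDeriv (WithTop.coe_lt_coe.2 (ENat.coe_lt_top k))
    rw [hdiff.iteratedFDeriv_succ_apply_left']
    -- the inner jet is in normal form on the open set, hence so is its derivative at `z`
    have hL : EqOn (fun y : P × ℝ => iteratedFDeriv ℝ k (fun z : P × ℝ => Φ i (g z.1) z.2) y (Fin.tail w))
        (fun y : P × ℝ => iteratedDeriv ((List.ofFn (σ ∘ Fin.succ)).count true) (Φ i (gt y.1)) y.2) (univ ×ˢ T i) :=
      fun y hy => hIH i y hy.2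
    have e1 := eqOn_fderiv_apply_of_eqOn hO hL (w 0) hzO
    simp only [] at e1
    rw [e1]
    cases h0 : σ 0 with
    | true =>
      -- normal letter: the jet order goes up by one
      rw [hwn 0 h0]
      simp only [if_true, Nat.add_comm 1]
      exact fderiv_iteratedDeriv_reader_normal (hT i) (Φ i) gt (h1 i gt hAdmt) _ hz
    | false =>
      -- transversal letter `(v, 0)`: the derivative passes onto the family
      have hw0 : w 0 = ((w 0).1, (0 : ℝ)) := Prod.ext rfl (hwt 0 h0)
      rw [hw0]
      simp only [Bool.false_eq_true, if_false, Nat.zero_add]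
      exact fderiv_iteratedDeriv_reader_transversal (hT i) (Φ i) gt (D (w 0).1 gt) (h1 i gt hAdmt) (h1 i _ (hcl _ hAdmt _)) (w 0).1
        (fun y hy => h2 i gt hAdmt (w 0).1 y hy) _ hz

/-- **Pure-normal words**: if every letter is `(0,1)`, the family is untouched and the jet is the `k`-th normal derivative `iteratedDeriv k (Φ i (g z.1)) z.2` (the (B-norm) case).
[cite: HormanderALPDO1, §1.1 (1.1.9)] -/
theorem iteratedFDeriv_readers_const_normal_eq_iteratedDeriv (T : ι → Set ℝ) (hT : ∀ i, IsOpen (T i)) (Φ : ι → (Y → V) → ℝ → F)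
    (Adm : (P → Y → V) → Prop) (D : P → (P → Y → V) → (P → Y → V))
    (hcl : ∀ g, Adm g → ∀ v, Adm (D v g))
    (h1 : ∀ i g, Adm g → ContDiffOn ℝ ∞ (fun z : P × ℝ => Φ i (g z.1) z.2) (univ ×ˢ T i))
    (h2 : ∀ i g, Adm g → ∀ (v : P) (z : P × ℝ), z.2 ∈ T i → fderiv ℝ (fun z : P × ℝ => Φ i (g z.1) z.2) z (v, 0) = Φ i (D v g z.1) z.2)
    (k : ℕ) (g : P → Y → V) (hg : Adm g) (i : ι) (z : P × ℝ) (hz : z.2 ∈ T i) :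
    iteratedFDeriv ℝ k (fun z : P × ℝ => Φ i (g z.1) z.2) z (fun _ => ((0 : P), (1 : ℝ))) = iteratedDeriv k (Φ i (g z.1)) z.2 := by
  have h := (iteratedFDeriv_readers_eq_iteratedDeriv_foldr T hT Φ Adm D hcl h1 h2 (fun _ : Fin k => ((0 : P), (1 : ℝ))) (fun _ => true)
    (fun _ _ => rfl) (fun _ h => by simp at h) g hg).2 i z hz
  rw [h]
  congr 1
  · simp
  · congr 1
    suffices hf : ∀ (l : List (Bool × P)), (∀ x ∈ l, x.1 = true) → l.foldr (fun l g => if l.1 then g else D l.2 g) g = g by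
      rw [hf _ (by simp)]
    intro l hl
    induction l with
    | nil => rfl
    | cons a l ihl =>
      rw [List.foldr_cons, ihl (fun x hx => hl x (List.mem_cons_of_mem _ hx)), if_pos (hl a (by simp))]

end NormalForm

end Literature.Analysis.Calculus
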